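import Mathlib
import Summits.Ventures.PercRepro2.Defs
import Summits.Ventures.PercRepro2.Graph
import Summits.Ventures.PercRepro2.OneColourSwitch
import Summits.Ventures.PercRepro2.RegionHubSign
import Summits.Ventures.PercRepro2.SideSwitch
import Summits.Ventures.PercRepro2.SideSwitchFibre
import Summits.Ventures.PercRepro2.SideSwitchClosed
import Summits.Ventures.PercRepro2.SideSwitchComps
import Summits.Ventures.PercRepro2.SideSwitchCompsFibre
import Summits.Ventures.PercRepro2.M9NoPocketDefs
import Summits.Ventures.PercRepro2.M9NoPocketWorld

/-!
# The single-`d` class without a pocket — the worlds in `G` of an assignment (blind cell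
PercRepro2, p3 g20, 2026-08-27; `proofs/P3-CPNC.md` §17c (iii))

Under the no-pocket hypothesis and half of the legality condition, the `Y`-world of `{r, s}` in
`G` of an assignment is its `Y`-world in `G − d` together with `d` exactly when `d` has a
`Y`-source (`K2_assignX`); symmetrically for the `W`-world (`M2_assignX`).  The proofs are
closure arguments: the only edges leaving the `G − d` world go to `d`, and `d`'s open edges go
to `r, s`, to `A`-side blocks, or — excluded by legality — to `B`-side blocks; no edge of `d`
reaches the unexplored part.  Own work; std axioms.
-/

namespace Summit.Ventures.PercRepro2

namespace NoPocket

open Finset Classical RegionHub OneColourSwitch SideSwitch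

variable {V : Type*} {E : Type*}

section Worlds

variable [Fintype V] [DecidableEq V] [Fintype E] [DecidableEq E]

variable {ends : E → Sym2 V}

omit [Fintype V] [DecidableEq V] [Fintype E] [DecidableEq E] in
/-- The `Y`-world of `G − d` is contained in the `Y`-world of `G`. -/
lemma K2_endsD_subset_K2 {d r s : V} (ω : Config E) :
    K2 (endsD ends d) r s ω ⊆ K2 ends r s ω := by
  intro y hy
  rcases mem_K2_iff.1 hy with hc | hc
  · exact mem_K2_iff.2 (Or.inl (conn_of_conn_endsD hc))
  · exact mem_K2_iff.2 (Or.inr (conn_of_conn_endsD hc))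

omit [Fintype V] [DecidableEq V] [Fintype E] [DecidableEq E] in
/-- The `W`-world of `G − d` is contained in the `W`-world of `G`. -/
lemma M2_endsD_subset_M2 {d r s : V} (ω : Config E) :
    M2 (endsD ends d) r s ω ⊆ M2 ends r s ω :=
  K2_endsD_subset_K2 (OneColourSwitch.compl ω)

omit [Fintype E] [DecidableEq E] in
/-- The block of a sided vertex of `G − d`. -/
lemma block_of_mem_A0 {d r s : V} {ρ : Config E} {y : V} (hy : y ∈ A0 (endsD ends d) r s ρ) :
    compIn (endsD ends d) (↑(A0 (endsD ends d) r s ρ) : Set V) y ∈ blocks ends d r s ρ ∧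
      y ∈ compIn (endsD ends d) (↑(A0 (endsD ends d) r s ρ) : Set V) y :=
  ⟨Finset.mem_image.2 ⟨y, hy, rfl⟩, mem_compIn_self _ _⟩

/-- A block vertex not in the switched union has its block unswitched. -/
lemma block_notMem_of_notMem_unionT {p q r s d : V} {ρ : Config E} (_hρ : ρ ∈ RepD ends p q r s d)
    {x : Finset (Finset V) × Finset E} (_hT : x.1 ⊆ blocks ends d r s ρ) {C : Finset V}
    (_hC : C ∈ blocks ends d r s ρ) {y : V} (hy : y ∈ C) (hyT : y ∉ unionT x.1) : C ∉ x.1 :=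
  fun hCx => hyT (mem_unionT.2 ⟨C, hCx, hy⟩)

/-- A block vertex of a representative lies in the `Y`-world of `G − d`. -/
lemma mem_K2_endsD_of_block {p q r s d : V} {ρ : Config E} (hρ : ρ ∈ RepD ends p q r s d)
    {C : Finset V} (hC : C ∈ blocks ends d r s ρ) {y : V} (hy : y ∈ C) :
    y ∈ K2 (endsD ends d) r s ρ :=
  A0_subset_K2_of_mem_Rep (mem_Rep_endsD_of_mem_RepD hρ)
    (subset_A0_of_mem_comps (ends := endsD ends d) hC hy)

/-- `d` with a `Y`-source lies in the `Y`-world of `G`. -/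
lemma d_mem_K2_of_srcY {p q r s d : V} {ρ : Config E} (hρ : ρ ∈ RepD ends p q r s d)
    {x : Finset (Finset V) × Finset E} (hT : x.1 ⊆ blocks ends d r s ρ)
    (hF : x.2 ⊆ Tset ends d r s) (hr : d ≠ r) (hs : d ≠ s) (hsrc : srcY ends d r s ρ x) :
    d ∈ K2 ends r s (assignX ends x ρ) := by
  rcases hsrc with ⟨e, he, hex⟩ | ⟨C, hC, hCx, e, y, hy, hends, hρe⟩
  · have hopen : assignX ends x ρ e = true := (assignX_Tset_eq_true_iff hρ hT hr hs he).2 hex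
    rcases mem_Tset.1 he with h | h
    · exact mem_K2_iff.2 (Or.inl (conn_symm (conn_of_openAdj ⟨e, hopen, h⟩)))
    · exact mem_K2_iff.2 (Or.inr (conn_symm (conn_of_openAdj ⟨e, hopen, h⟩)))
  · have hopen : assignX ends x ρ e = true := by
      rw [assignX_block_edge hρ hT hF hr hs hC hy hends, if_neg hCx]; exact hρe
    have hyK' : y ∈ K2 (endsD ends d) r s (assignX ends x ρ) := by
      rw [K2_endsD_assignX hρ hT hF]
      refine ⟨mem_K2_endsD_of_block hρ hC hy, ?_⟩
      intro hyT
      exact hCx (block_mem_of_mem_unionT hρ hT hC hy (Finset.mem_coe.1 hyT))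
    exact mem_K2_of_open (K2_endsD_subset_K2 _ hyK') hopen (by rw [hends, Sym2.eq_swap])

/-- A `T`-edge of an assignment is `W` iff it is in `x.2`. -/
lemma assignX_Tset_eq_false_iff {p q r s d : V} {ρ : Config E} (hρ : ρ ∈ RepD ends p q r s d)
    {x : Finset (Finset V) × Finset E} (hT : x.1 ⊆ blocks ends d r s ρ) (hr : d ≠ r) (hs : d ≠ s)
    {e : E} (he : e ∈ Tset ends d r s) : assignX ends x ρ e = false ↔ e ∈ x.2 := by
  have := assignX_Tset_eq_true_iff hρ hT hr hs he
  cases h : assignX ends x ρ e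
  · simp only [h, Bool.false_eq_true, false_iff, not_not] at this
    simp [this]
  · simp only [h, true_iff] at this
    simp [this]

/-- `d` with a `W`-source lies in the `W`-world of `G`. -/
lemma d_mem_M2_of_srcW {p q r s d : V} {ρ : Config E} (hρ : ρ ∈ RepD ends p q r s d)
    {x : Finset (Finset V) × Finset E} (hT : x.1 ⊆ blocks ends d r s ρ)
    (hF : x.2 ⊆ Tset ends d r s) (hr : d ≠ r) (hs : d ≠ s) (hsrc : srcW ends d r s ρ x) :
    d ∈ M2 ends r s (assignX ends x ρ) := by
  rcases hsrc with ⟨e, hex, he⟩ | ⟨C, hCx, e, y, hy, hends, hρe⟩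
  · have hopen : assignX ends x ρ e = false := (assignX_Tset_eq_false_iff hρ hT hr hs he).2 hex
    rcases mem_Tset.1 he with h | h
    · exact mem_M2_of_closed (r_mem_M2 r s _) hopen (by rw [h, Sym2.eq_swap])
    · exact mem_M2_of_closed (s_mem_M2 r s _) hopen (by rw [h, Sym2.eq_swap])
  · have hC : C ∈ blocks ends d r s ρ := hT hCx
    have hopen : assignX ends x ρ e = false := by
      rw [assignX_block_edge hρ hT hF hr hs hC hy hends, if_pos hCx, hρe]; rfl
    have hyM' : y ∈ M2 (endsD ends d) r s (assignX ends x ρ) := by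
      rw [M2_endsD_assignX hρ hT hF]
      exact Or.inr (Finset.mem_coe.2 (mem_unionT.2 ⟨C, hCx, hy⟩))
    exact mem_M2_of_closed (M2_endsD_subset_M2 _ hyM') hopen (by rw [hends, Sym2.eq_swap])

omit [Fintype E] [DecidableEq E] in
/-- A vertex of the `Y`-world of `G − d` is `r`, `s` or sided. -/
lemma mem_A0_of_mem_K2_endsD {d r s : V} {ω : Config E} {y : V}
    (hy : y ∈ K2 (endsD ends d) r s ω) : y = r ∨ y = s ∨ y ∈ A0 (endsD ends d) r s ω := by
  by_cases hr : y = r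
  · exact Or.inl hr
  by_cases hs : y = s
  · exact Or.inr (Or.inl hs)
  exact Or.inr (Or.inr (mem_A0.2 ⟨Or.inl hy, hr, hs⟩))

omit [Fintype E] [DecidableEq E] in
/-- A vertex of the `W`-world of `G − d` is `r`, `s` or sided. -/
lemma mem_A0_of_mem_M2_endsD {d r s : V} {ω : Config E} {y : V}
    (hy : y ∈ M2 (endsD ends d) r s ω) : y = r ∨ y = s ∨ y ∈ A0 (endsD ends d) r s ω := by
  by_cases hr : y = r
  · exact Or.inl hr
  by_cases hs : y = s
  · exact Or.inr (Or.inl hs)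
  exact Or.inr (Or.inr (mem_A0.2 ⟨Or.inr hy, hr, hs⟩))

omit [Fintype V] [DecidableEq V] [Fintype E] [DecidableEq E] in
/-- Under the no-pocket hypothesis a neighbour of `d` other than `r, s, d` lies in a world of
`G − d` of every colouring. -/
lemma neighbour_mem_worlds {d r s : V} (hnp : NoPocketAt ends d r s) (hr : d ≠ r) (hs : d ≠ s)
    (ω : Config E) {e : E} {w : V} (he : ends e = s(d, w)) (hwd : w ≠ d) (hwr : w ≠ r)
    (hws : w ≠ s) : w ∈ K2 (endsD ends d) r s ω ∨ w ∈ M2 (endsD ends d) r s ω := by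
  obtain ⟨e', he'⟩ := hnp e w he hwd hwr hws
  rcases he' with h | h
  · have hd : d ∉ ends e' := notMem_of_ends_ne h hwd hr.symm
    cases hc : ω e'
    · exact Or.inr (mem_M2_of_closed (r_mem_M2 r s ω) hc
        (by rw [endsD_of_notMem hd, h, Sym2.eq_swap]))
    · exact Or.inl (mem_K2_of_open (r_mem_K2 r s ω) hc
        (by rw [endsD_of_notMem hd, h, Sym2.eq_swap]))
  · have hd : d ∉ ends e' := notMem_of_ends_ne h hwd hs.symm
    cases hc : ω e'
    · exact Or.inr (mem_M2_of_closed (s_mem_M2 r s ω) hc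
        (by rw [endsD_of_notMem hd, h, Sym2.eq_swap]))
    · exact Or.inl (mem_K2_of_open (s_mem_K2 r s ω) hc
        (by rw [endsD_of_notMem hd, h, Sym2.eq_swap]))

/-- **The `Y`-world of an assignment**: the `Y`-world of `G − d` together with `d` exactly when
`d` has a `Y`-source (under the no-pocket hypothesis and the `Y`-half of legality). -/
theorem K2_assignX {p q r s d : V} (hnp : NoPocketAt ends d r s) {ρ : Config E}
    (hρ : ρ ∈ RepD ends p q r s d) {x : Finset (Finset V) × Finset E}
    (hT : x.1 ⊆ blocks ends d r s ρ) (hF : x.2 ⊆ Tset ends d r s) (hr : d ≠ r) (hs : d ≠ s)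
    (hL : srcY ends d r s ρ x → ∀ C ∈ x.1, ¬ hasW ends d ρ C) :
    K2 ends r s (assignX ends x ρ) =
      K2 (endsD ends d) r s (assignX ends x ρ) ∪ {y | y = d ∧ srcY ends d r s ρ x} := by
  set ω := assignX ends x ρ with hω
  apply Set.Subset.antisymm
  · have hcl : ∀ z ∈ K2 (endsD ends d) r s ω ∪ {y | y = d ∧ srcY ends d r s ρ x}, ∀ w,
        (openGraph ends ω).Adj z w →
          w ∈ K2 (endsD ends d) r s ω ∪ {y | y = d ∧ srcY ends d r s ρ x} := by
      intro z hz w hzw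
      obtain ⟨_, e, he, hends⟩ := openGraph_adj.1 hzw
      rcases hz with hzK | ⟨hzd, hsrc⟩
      · have hzd : z ≠ d := fun h => not_mem_K2_endsD hr hs ω (h ▸ hzK)
        by_cases hwd : w = d
        · -- an open edge from the `G − d` world to `d`: a `Y`-source
          refine Or.inr ⟨hwd, ?_⟩
          rw [hwd] at hends
          rcases mem_A0_of_mem_K2_endsD hzK with hzr | hzs | hzA
          · have he' : e ∈ Tset ends d r s :=
              mem_Tset.2 (Or.inl (by rw [hends, hzr, Sym2.eq_swap]))
            exact Or.inl ⟨e, he', (assignX_Tset_eq_true_iff hρ hT hr hs he').1 he⟩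
          · have he' : e ∈ Tset ends d r s :=
              mem_Tset.2 (Or.inr (by rw [hends, hzs, Sym2.eq_swap]))
            exact Or.inl ⟨e, he', (assignX_Tset_eq_true_iff hρ hT hr hs he').1 he⟩
          · rw [A0_endsD_assignX hρ hT hF] at hzA
            obtain ⟨hC, hzC⟩ := block_of_mem_A0 hzA
            have hzT : z ∉ unionT x.1 := by
              intro hzT
              rw [K2_endsD_assignX hρ hT hF] at hzK
              exact hzK.2 (Finset.mem_coe.2 hzT)
            have hCx := block_notMem_of_notMem_unionT hρ hT hC hzC hzT
            have hends' : ends e = s(d, z) := by rw [hends, Sym2.eq_swap]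
            have hval := assignX_block_edge hρ hT hF hr hs hC hzC hends'
            rw [if_neg hCx] at hval
            exact Or.inr ⟨_, hC, hCx, e, z, hzC, hends', by rw [← hval]; exact he⟩
        · have hd : d ∉ ends e := notMem_of_ends_ne hends hzd hwd
          exact Or.inl (mem_K2_of_open hzK he (by rw [endsD_of_notMem hd, hends]))
      · -- an open edge at `d`
        rw [hzd] at hends
        by_cases hwd : w = d
        · exact Or.inr ⟨hwd, hsrc⟩
        by_cases hwr : w = r
        · rw [hwr]; exact Or.inl (r_mem_K2 r s ω)
        by_cases hws : w = s
        · rw [hws]; exact Or.inl (s_mem_K2 r s ω)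
        rcases neighbour_mem_worlds hnp hr hs ω hends hwd hwr hws with hwK | hwM
        · exact Or.inl hwK
        · -- a `B`-side block vertex joined to `d` by a `Y` edge: a dead edge, excluded
          exfalso
          rw [M2_endsD_assignX hρ hT hF] at hwM
          obtain ⟨_, hM', _⟩ := mem_RepD.1 hρ
          rcases hwM with hwM | hwT
          · rcases hM' w hwM with h | h
            · exact hwr h
            · exact hws h
          · have hwA : w ∈ A0 (endsD ends d) r s ρ :=
              unionT_subset_A0 (ends := endsD ends d) hT (Finset.mem_coe.1 hwT)
            obtain ⟨hC, hwC⟩ := block_of_mem_A0 hwA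
            have hCx : _ ∈ x.1 := block_mem_of_mem_unionT hρ hT hC hwC (Finset.mem_coe.1 hwT)
            have hval := assignX_block_edge hρ hT hF hr hs hC hwC hends
            rw [if_pos hCx] at hval
            have hρe : ρ e = false := by
              rw [hω, hval] at he
              simpa using he
            exact hL hsrc _ hCx ⟨e, w, hwC, hends, hρe⟩
    intro y hy
    rcases mem_K2_iff.1 hy with hc | hc
    · exact mem_of_conn_of_closed hcl (Or.inl (r_mem_K2 r s ω)) hc
    · exact mem_of_conn_of_closed hcl (Or.inl (s_mem_K2 r s ω)) hc
  · rintro y (hy | ⟨rfl, hsrc⟩)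
    · exact K2_endsD_subset_K2 ω hy
    · exact d_mem_K2_of_srcY hρ hT hF hr hs hsrc

/-- **The `W`-world of an assignment**: the `W`-world of `G − d` together with `d` exactly when
`d` has a `W`-source (under the no-pocket hypothesis and the `W`-half of legality). -/
theorem M2_assignX {p q r s d : V} (hnp : NoPocketAt ends d r s) {ρ : Config E}
    (hρ : ρ ∈ RepD ends p q r s d) {x : Finset (Finset V) × Finset E}
    (hT : x.1 ⊆ blocks ends d r s ρ) (hF : x.2 ⊆ Tset ends d r s) (hr : d ≠ r) (hs : d ≠ s)
    (hL : srcW ends d r s ρ x → ∀ C ∈ blocks ends d r s ρ, C ∉ x.1 → ¬ hasW ends d ρ C) :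
    M2 ends r s (assignX ends x ρ) =
      M2 (endsD ends d) r s (assignX ends x ρ) ∪ {y | y = d ∧ srcW ends d r s ρ x} := by
  set ω := assignX ends x ρ with hω
  apply Set.Subset.antisymm
  · have hcl : ∀ z ∈ M2 (endsD ends d) r s ω ∪ {y | y = d ∧ srcW ends d r s ρ x}, ∀ w,
        (openGraph ends (OneColourSwitch.compl ω)).Adj z w →
          w ∈ M2 (endsD ends d) r s ω ∪ {y | y = d ∧ srcW ends d r s ρ x} := by
      intro z hz w hzw
      obtain ⟨_, e, he, hends⟩ := openGraph_adj.1 hzw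
      have he' : ω e = false := by simpa [OneColourSwitch.compl] using he
      rcases hz with hzM | ⟨hzd, hsrc⟩
      · have hzd : z ≠ d := fun h => not_mem_M2_endsD hr hs ω (h ▸ hzM)
        by_cases hwd : w = d
        · -- a closed edge from the `G − d` world to `d`: a `W`-source
          refine Or.inr ⟨hwd, ?_⟩
          rw [hwd] at hends
          rcases mem_A0_of_mem_M2_endsD hzM with hzr | hzs | hzA
          · have he'' : e ∈ Tset ends d r s :=
              mem_Tset.2 (Or.inl (by rw [hends, hzr, Sym2.eq_swap]))
            exact Or.inl ⟨e, (assignX_Tset_eq_false_iff hρ hT hr hs he'').1 he', he''⟩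
          · have he'' : e ∈ Tset ends d r s :=
              mem_Tset.2 (Or.inr (by rw [hends, hzs, Sym2.eq_swap]))
            exact Or.inl ⟨e, (assignX_Tset_eq_false_iff hρ hT hr hs he'').1 he', he''⟩
          · rw [A0_endsD_assignX hρ hT hF] at hzA
            obtain ⟨hC, hzC⟩ := block_of_mem_A0 hzA
            have hzT : z ∈ unionT x.1 := by
              rw [M2_endsD_assignX hρ hT hF] at hzM
              obtain ⟨_, hM', _⟩ := mem_RepD.1 hρ
              obtain ⟨_, hzr', hzs'⟩ := mem_A0.1 hzA
              rcases hzM with hzM | hzT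
              · rcases hM' z hzM with h | h
                · exact (hzr' h).elim
                · exact (hzs' h).elim
              · exact Finset.mem_coe.1 hzT
            have hCx := block_mem_of_mem_unionT hρ hT hC hzC hzT
            have hends' : ends e = s(d, z) := by rw [hends, Sym2.eq_swap]
            have hval := assignX_block_edge hρ hT hF hr hs hC hzC hends'
            rw [if_pos hCx] at hval
            have hρe : ρ e = true := by
              rw [hω, hval] at he'
              simpa using he'
            exact Or.inr ⟨_, hCx, e, z, hzC, hends', hρe⟩
        · have hd : d ∉ ends e := notMem_of_ends_ne hends hzd hwd
          exact Or.inl (mem_M2_of_closed hzM he' (by rw [endsD_of_notMem hd, hends]))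
      · -- a closed edge at `d`
        rw [hzd] at hends
        by_cases hwd : w = d
        · exact Or.inr ⟨hwd, hsrc⟩
        by_cases hwr : w = r
        · rw [hwr]; exact Or.inl (r_mem_M2 r s ω)
        by_cases hws : w = s
        · rw [hws]; exact Or.inl (s_mem_M2 r s ω)
        rcases neighbour_mem_worlds hnp hr hs ω hends hwd hwr hws with hwK | hwM
        · -- an `A`-side block vertex joined to `d` by a `W` edge: a dead edge, excluded
          exfalso
          rw [K2_endsD_assignX hρ hT hF] at hwK
          obtain ⟨hwK', hwT⟩ := hwK
          have hwA : w ∈ A0 (endsD ends d) r s ρ := mem_A0.2 ⟨Or.inl hwK', hwr, hws⟩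
          obtain ⟨hC, hwC⟩ := block_of_mem_A0 hwA
          have hCx := block_notMem_of_notMem_unionT hρ hT hC hwC
            (fun h => hwT (Finset.mem_coe.2 h))
          have hval := assignX_block_edge hρ hT hF hr hs hC hwC hends
          rw [if_neg hCx] at hval
          have hρe : ρ e = false := by rw [hω, hval] at he'; exact he'
          exact hL hsrc _ hC hCx ⟨e, w, hwC, hends, hρe⟩
        · exact Or.inl hwM
    intro y hy
    rcases mem_M2_iff.1 hy with hc | hc
    · exact mem_of_conn_of_closed hcl (Or.inl (r_mem_M2 r s ω)) hc
    · exact mem_of_conn_of_closed hcl (Or.inl (s_mem_M2 r s ω)) hc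
  · rintro y (hy | ⟨rfl, hsrc⟩)
    · exact M2_endsD_subset_M2 ω hy
    · exact d_mem_M2_of_srcW hρ hT hF hr hs hsrc

end Worlds

end NoPocket

end Summit.Ventures.PercRepro2
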